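import Summits.QuantumFields.YangMills.Theorems.SwapVirialDeficitSwapMeanActionGapOfSharpSectorLaplace
import HarnessLib

/-!
# Route `SwapVirialDeficit` (YangMills): the W9 bookkeeping and the two route closers FROM BULK∕REST DATA AT A GENERAL BULK RATE `b^{−θ₂}`
# ((S)-road assembler fcl-p3 g47, LEAD g97 'GO' 2026-08-31 17:34Z)

The landed W9 chain — ✓`QuantitativeLaplace.sharpLaw_on_window_of_bulk_rest` (w2 g58) ⟹ ✓`SwapRing.swapGluedStiffness_of_bulk_rest` (⟨24197⟩) and
✓`SwapRing.swapMeanActionGap_of_bulk_rest` (LEAD g97, ⟨24194⟩) — hard-codes the bulk rate `|I_bulk − Main| ≤ K₂L^{q₂}·b^{−1∕2}·Main`.  No architecture with the cone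
tip of the σ-glued flat bottom can meet `b^{−1∕2}`: the bulk∕tip cut must be `b`-dependent (`ψ₀(b) = b^{−σ}`, else the tip keeps a fixed fraction of the Morse–Bott
main term and the rest is not `o(Main)`), and then the fibred-Laplace constants of the bulk (`poly(1∕λ)`, `λ = λ(ψ₀(b)) = poly(L)·b^{−2σ}`) grow like `b^{+cσ}` — the
honest bulk rate is `b^{−θ₂}`, `θ₂ = min(1∕2 − cσ, σκ) > 0` (LEAD ruling 17:34Z).  This file re-issues the three theorems with `b^{−1∕2}` replaced by `b^{−θ₂}`,
`0 < θ₂ ≤ 1` (proofs verbatim; `θ := min θ₂ θ₃`; `θ₂ := 1∕2` recovers the landed statements):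

* ★★★ `QuantitativeLaplace.sharpLaw_on_window_of_bulk_rest_rate`;
* ★★★ `SwapRing.swapGluedStiffness_of_bulk_rest_rate` — ⟨24197⟩ `SwapGluedStiffness` from the θ₂-general per-sector data;
* ★★★ `SwapRing.swapMeanActionGap_of_bulk_rest_rate` — ⟨24194⟩ `SwapMeanActionGap` from the SAME data (same hypotheses, same binder names).

These `h₀`∕`h₁` clauses are the target of the (S)-road skeleton (`fcl-p3-g47-SectorLaplaceSkeleton.lean`, cell ym-idea-1).

HONEST LABEL: bookkeeping ∕ reductions only; the per-sector Morse–Bott data (S) are NOT supplied here; ⟨24197⟩ ∕ ⟨24194⟩ OPEN; ⟨24196⟩ proved (✓`toronSoftnessSharp_proof`);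
item of record ⟨24085⟩ SubOctaveBounded aside ∕ untouched; the Yang–Mills mass gap is NOT proved; no summit is proved by a line.  THEOREMS ONLY (0 `def`, 0 `sorry`),
standard axioms.  Seat ym-line-fcl-p3 g47 (cell ym-idea-1, free hands), `--supports stmt-QuantumFields-24197`.  References: [cite: tHooft1979]; [cite: Luscher1983, §2]; [folklore].
-/

set_option autoImplicit false

noncomputable section

open MeasureTheory Set Real
open Literature.MathematicalPhysics.QuantumFieldTheory hiding SU2
open Literature.MathematicalPhysics.QuantumLattice

/-! ## §1 W9 at a general bulk rate -/

namespace Summit.QuantumFields.YangMills.Theorems.QuantitativeLaplace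

/-- ★★★ **W9 at a general bulk rate `θ₂` — THE SHARP LOG LAW ON THE STEEP WINDOW FROM POLYNOMIAL BULK∕REST DATA** (✓`sharpLaw_on_window_of_bulk_rest`
with the hard-coded bulk rate `b^{−1∕2}` replaced by `b^{−θ₂}`, `0 < θ₂ ≤ 1`; `θ₂ = 1∕2` is the landed statement).  For `L ≥ L₀ ≥ 1`, `b ≥ K₁L^{q₁}`:
`I_bulk ≤ I L b ≤ I_bulk + R`, `|I_bulk − (2π∕b)^{e L}𝔐 L| ≤ K₂L^{q₂}b^{−θ₂}·Main`, `R ≤ K₃L^{q₃}b^{−θ₃}·Main` ⟹ `|log I − (−e log b + (log 𝔐 + e log 2π))| ≤ K L^q b^{−θ}`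
on a window `L ≤ b^a`, `θ = min θ₂ θ₃`.  WHY THE GENERAL RATE IS NEEDED (LEAD ruling 2026-08-31 17:34Z): with the cone tip of the σ-glued bottom the bulk∕tip cut is
`ψ₀(b) = b^{−σ}`, so the bulk's fibred constants grow like `b^{+cσ}` and the honest bulk rate is `b^{−1∕2+cσ}`, not `b^{−1∕2}`. [folklore] -/
theorem sharpLaw_on_window_of_bulk_rest_rate {I : ℕ → ℝ → ℝ} {e 𝔐 : ℕ → ℝ} {K₁ K₂ K₃ θ₂ θ₃ : ℝ} {q₁ q₂ q₃ L₀ : ℕ}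
    (hK₁ : 0 < K₁) (hK₂ : 0 ≤ K₂) (hK₃ : 0 ≤ K₃) (hθ₂ : 0 < θ₂) (hθ₂1 : θ₂ ≤ 1) (hθ₃ : 0 < θ₃) (hq₁ : 1 ≤ q₁) (hL₀ : 1 ≤ L₀)
    (h𝔐 : ∀ L : ℕ, L₀ ≤ L → 0 < 𝔐 L)
    (h : ∀ L : ℕ, L₀ ≤ L → ∀ b : ℝ, K₁ * (L : ℝ) ^ q₁ ≤ b → ∃ Ib R : ℝ, Ib ≤ I L b ∧ I L b ≤ Ib + R ∧
      |Ib - (2 * π / b) ^ (e L) * 𝔐 L| ≤ (K₂ * (L : ℝ) ^ q₂ * b ^ (-θ₂)) * ((2 * π / b) ^ (e L) * 𝔐 L) ∧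
      R ≤ (K₃ * (L : ℝ) ^ q₃ * b ^ (-θ₃)) * ((2 * π / b) ^ (e L) * 𝔐 L)) :
    ∃ a : ℝ, 0 < a ∧ ∃ K : ℝ, 0 < K ∧ ∃ q : ℕ, ∃ θ : ℝ, 0 < θ ∧ θ ≤ 1 ∧ ∃ β₀ : ℝ, ∀ b : ℝ, β₀ ≤ b → ∀ L : ℕ, L₀ ≤ L → (L : ℝ) ≤ b ^ a →
      0 < I L b ∧ |Real.log (I L b) - (-(e L) * Real.log b + (Real.log (𝔐 L) + e L * Real.log (2 * π)))| ≤ K * (L : ℝ) ^ q * b ^ (-θ) := by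
  set θ : ℝ := min θ₂ θ₃ with hθdef
  have hθ0 : 0 < θ := lt_min hθ₂ hθ₃
  have hθ1 : θ ≤ 1 := (min_le_left _ _).trans hθ₂1
  have hθhalf : θ ≤ θ₂ := min_le_left _ _
  have hθθ₃ : θ ≤ θ₃ := min_le_right _ _
  set q : ℕ := max q₂ q₃ with hqdef
  set K : ℝ := 2 * (K₂ + K₃) + 1 with hKdef
  have hK0 : 0 < K := by rw [hKdef]; linarith
  have hK1 : 1 ≤ K := by rw [hKdef]; linarith
  set a : ℝ := min (1 / (2 * (q₁ : ℝ))) (θ / (2 * ((q : ℝ) + 1))) with hadef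
  have hq₁0 : (0 : ℝ) < q₁ := by exact_mod_cast hq₁
  have hq0 : (0 : ℝ) ≤ q := Nat.cast_nonneg _
  have ha0 : 0 < a := lt_min (by positivity) (by positivity)
  set β₀ : ℝ := max (max 1 (K₁ ^ 2)) (K ^ (2 / θ)) with hβ₀def
  refine ⟨a, ha0, K, hK0, q, θ, hθ0, hθ1, β₀, fun b hb L hL hLb => ?_⟩
  -- the window facts
  have hb1 : 1 ≤ b := le_trans (le_trans (le_max_left _ _) (le_max_left _ _)) hb
  have hb0 : 0 < b := by linarith
  have hbK₁ : K₁ ^ 2 ≤ b := le_trans (le_trans (le_max_right _ _) (le_max_left _ _)) hb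
  have hbK : K ^ (2 / θ) ≤ b := le_trans (le_max_right _ _) hb
  have hL1 : (1 : ℝ) ≤ L := by exact_mod_cast hL₀.trans hL
  have hL0' : (0 : ℝ) ≤ L := by linarith
  -- (1) the polynomial threshold holds on the window
  have hLq₁ : (L : ℝ) ≤ b ^ (1 / (2 * (q₁ : ℝ))) :=
    hLb.trans (Real.rpow_le_rpow_of_exponent_le hb1 (min_le_left _ _))
  have hthr : K₁ * (L : ℝ) ^ q₁ ≤ b := mul_pow_le_of_le_rpow_window hK₁ hq₁ hb1 hbK₁ hL0' hLq₁
  obtain ⟨Ib, R, hlow, hup, hbulk, hR⟩ := h L hL b hthr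
  -- (2) the two relative errors are ≤ K₂ L^q b^{-θ}, K₃ L^q b^{-θ}
  set ε : ℝ := K₂ * (L : ℝ) ^ q₂ * b ^ (-θ₂) with hεdef
  set ω : ℝ := K₃ * (L : ℝ) ^ q₃ * b ^ (-θ₃) with hωdef
  have hε' : ε ≤ K₂ * (L : ℝ) ^ q * b ^ (-θ) := monomial_le_of_window hK₂ hL1 hb1 (le_max_left _ _) hθhalf
  have hω' : ω ≤ K₃ * (L : ℝ) ^ q * b ^ (-θ) := monomial_le_of_window hK₃ hL1 hb1 (le_max_right _ _) hθθ₃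
  -- (3) `L^q ≤ b^{aq}` and `(K₂+K₃) b^{aq−θ} ≤ (K₂+K₃) b^{−θ/2} ≤ 1/2·…`: ε + ω ≤ 1/2
  have hLq : (L : ℝ) ^ q ≤ b ^ (a * q) := by
    calc (L : ℝ) ^ q ≤ (b ^ a) ^ q := pow_le_pow_left₀ hL0' hLb q
      _ = b ^ (a * q) := by rw [← Real.rpow_natCast, ← Real.rpow_mul hb0.le]
  have haq : a * q ≤ θ / 2 := by
    have h1 : a ≤ θ / (2 * ((q : ℝ) + 1)) := min_le_right _ _
    have h2 : a * q ≤ θ / (2 * ((q : ℝ) + 1)) * q := mul_le_mul_of_nonneg_right h1 hq0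
    refine h2.trans ?_
    rw [div_mul_eq_mul_div, div_le_div_iff₀ (by positivity) (by norm_num)]
    have : θ * (q : ℝ) * 2 ≤ θ * (2 * ((q : ℝ) + 1)) := by nlinarith [hθ0.le, hq0]
    linarith
  have hbpow : b ^ (a * q) * b ^ (-θ) ≤ b ^ (-(θ / 2)) := by
    rw [← Real.rpow_add hb0]
    exact Real.rpow_le_rpow_of_exponent_le hb1 (by linarith)
  -- `K · b^{−θ/2} ≤ 1` from `b ≥ K^{2/θ}`
  have hKb : K * b ^ (-(θ / 2)) ≤ 1 := by
    have h1 : K ≤ b ^ (θ / 2) := by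
      have h2 : (K ^ (2 / θ)) ^ (θ / 2) ≤ b ^ (θ / 2) := Real.rpow_le_rpow (by positivity) hbK (by positivity)
      rwa [← Real.rpow_mul hK0.le, show 2 / θ * (θ / 2) = 1 by field_simp, Real.rpow_one] at h2
    have h3 : 0 < b ^ (θ / 2) := Real.rpow_pos_of_pos hb0 _
    rw [Real.rpow_neg hb0.le, ← div_eq_mul_inv, div_le_one h3]
    exact h1
  have hsum : ε + ω ≤ 1 / 2 := by
    have h1 : ε + ω ≤ (K₂ + K₃) * (L : ℝ) ^ q * b ^ (-θ) := by
      have e2 : (K₂ + K₃) * (L : ℝ) ^ q * b ^ (-θ) = K₂ * (L : ℝ) ^ q * b ^ (-θ) + K₃ * (L : ℝ) ^ q * b ^ (-θ) := by ring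
      rw [e2]; exact add_le_add hε' hω'
    have h2 : (K₂ + K₃) * (L : ℝ) ^ q * b ^ (-θ) ≤ (K₂ + K₃) * (b ^ (a * q) * b ^ (-θ)) := by
      rw [mul_assoc]
      exact mul_le_mul_of_nonneg_left (mul_le_mul_of_nonneg_right hLq (Real.rpow_nonneg hb0.le _)) (by positivity)
    have h3 : (K₂ + K₃) * (b ^ (a * q) * b ^ (-θ)) ≤ (K₂ + K₃) * b ^ (-(θ / 2)) := mul_le_mul_of_nonneg_left hbpow (by positivity)
    have h4 : (K₂ + K₃) * b ^ (-(θ / 2)) ≤ 1 / 2 := by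
      have : 2 * (K₂ + K₃) * b ^ (-(θ / 2)) ≤ K * b ^ (-(θ / 2)) :=
        mul_le_mul_of_nonneg_right (by rw [hKdef]; linarith) (Real.rpow_nonneg hb0.le _)
      linarith
    linarith
  -- (4) the log law at this `b`
  have hbulk' : |Ib - (2 * π / b) ^ (2 * e L / 2) * 𝔐 L| ≤ ε * ((2 * π / b) ^ (2 * e L / 2) * 𝔐 L) := by
    rw [show 2 * e L / 2 = e L by ring]; exact hbulk
  have hR' : R ≤ ω * ((2 * π / b) ^ (2 * e L / 2) * 𝔐 L) := by
    rw [show 2 * e L / 2 = e L by ring]; exact hR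
  obtain ⟨hIpos, hlog⟩ := abs_log_sharp_of_bulk_rest (m := 2 * e L) (h𝔐 L hL) hb0 hlow hup hbulk' hR' hsum
  refine ⟨hIpos, ?_⟩
  have e1 : Real.log (𝔐 L) + 2 * e L / 2 * Real.log (2 * π) - 2 * e L / 2 * Real.log b =
      -(e L) * Real.log b + (Real.log (𝔐 L) + e L * Real.log (2 * π)) := by ring
  rw [e1] at hlog
  refine hlog.trans ?_
  -- `2(ε + ω) ≤ 2(K₂+K₃) L^q b^{−θ} ≤ K L^q b^{−θ}`
  have hmono : 0 ≤ (L : ℝ) ^ q * b ^ (-θ) := by positivity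
  have e3 : K * (L : ℝ) ^ q * b ^ (-θ) = 2 * (K₂ * (L : ℝ) ^ q * b ^ (-θ) + K₃ * (L : ℝ) ^ q * b ^ (-θ)) + (L : ℝ) ^ q * b ^ (-θ) := by
    rw [hKdef]; ring
  rw [e3]
  have h5 := add_le_add hε' hω'
  linarith

end Summit.QuantumFields.YangMills.Theorems.QuantitativeLaplace

/-! ## §2 The two route closers from θ₂-general bulk∕rest data -/

namespace Summit.QuantumFields.YangMills.Theorems.SwapVirialDeficit.SwapRing

open Summit.QuantumFields.YangMills.Theorems.FemtoTransferGap
open Summit.QuantumFields.YangMills.Theorems.VirialFluxGap.RingDeficit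
open Summit.QuantumFields.YangMills.Theorems.QuantitativeLaplace

/-- ★★★ **W9 — ⟨24197⟩ `SwapGluedStiffness` FROM PER-SECTOR, PER-`(L,b)` POLYNOMIAL BULK∕REST DATA AT A GENERAL BULK RATE `θ₂`** (w2 g58's
✓`swapGluedStiffness_of_bulk_rest` verbatim with `b^{−1∕2}` ↦ `b^{−θ₂}`, `0 < θ₂ ≤ 1`).  For each even sector `z₀ = 000`, `z₁ = 001`: exponents
`9L⁴ − 1 ≤ e_z L ≤ 9L⁴`, `𝔐_z L > 0`, and for `L ≥ L₀ ≥ 1`, `b ≥ K₁L^{q₁}`: `I_bulk ≤ Ẑ_z(L,b) ≤ I_bulk + R`,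
`|I_bulk − (2π∕b)^{e_z L}𝔐_z L| ≤ K₂L^{q₂}b^{−θ₂}·Main`, `R ≤ K₃L^{q₃}b^{−θ₃}·Main`.  Then `SwapGluedStiffness`. [cite: tHooft1979] [cite: Luscher1983, §2] [folklore] -/
theorem swapGluedStiffness_of_bulk_rest_rate {e₀ e₁ 𝔐₀ 𝔐₁ : ℕ → ℝ} {K₁ K₂ K₃ θ₂ θ₃ : ℝ} {q₁ q₂ q₃ L₀ : ℕ}
    (hK₁ : 0 < K₁) (hK₂ : 0 ≤ K₂) (hK₃ : 0 ≤ K₃) (hθ₂ : 0 < θ₂) (hθ₂1 : θ₂ ≤ 1) (hθ₃ : 0 < θ₃) (hq₁ : 1 ≤ q₁) (hL₀ : 1 ≤ L₀)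
    (hexp : ∀ L : ℕ, L₀ ≤ L → 9 * (L : ℝ) ^ 4 - 1 ≤ e₀ L ∧ e₀ L ≤ 9 * (L : ℝ) ^ 4 ∧ 9 * (L : ℝ) ^ 4 - 1 ≤ e₁ L ∧ e₁ L ≤ 9 * (L : ℝ) ^ 4)
    (h𝔐₀ : ∀ L : ℕ, L₀ ≤ L → 0 < 𝔐₀ L) (h𝔐₁ : ∀ L : ℕ, L₀ ≤ L → 0 < 𝔐₁ L)
    (h₀ : ∀ (L : ℕ) [NeZero L], L₀ ≤ L → ∀ b : ℝ, K₁ * (L : ℝ) ^ q₁ ≤ b → ∃ Ib R : ℝ,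
      Ib ≤ ∫ P, Real.exp (-(b * swapRingDeficit L (fun _ => false) P)) ∂(ringMeasure L) ∧
      (∫ P, Real.exp (-(b * swapRingDeficit L (fun _ => false) P)) ∂(ringMeasure L)) ≤ Ib + R ∧
      |Ib - (2 * Real.pi / b) ^ (e₀ L) * 𝔐₀ L| ≤ (K₂ * (L : ℝ) ^ q₂ * b ^ (-θ₂)) * ((2 * Real.pi / b) ^ (e₀ L) * 𝔐₀ L) ∧
      R ≤ (K₃ * (L : ℝ) ^ q₃ * b ^ (-θ₃)) * ((2 * Real.pi / b) ^ (e₀ L) * 𝔐₀ L))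
    (h₁ : ∀ (L : ℕ) [NeZero L], L₀ ≤ L → ∀ b : ℝ, K₁ * (L : ℝ) ^ q₁ ≤ b → ∃ Ib R : ℝ,
      Ib ≤ ∫ P, Real.exp (-(b * swapRingDeficit L (fun k => decide (k = 2)) P)) ∂(ringMeasure L) ∧
      (∫ P, Real.exp (-(b * swapRingDeficit L (fun k => decide (k = 2)) P)) ∂(ringMeasure L)) ≤ Ib + R ∧
      |Ib - (2 * Real.pi / b) ^ (e₁ L) * 𝔐₁ L| ≤ (K₂ * (L : ℝ) ^ q₂ * b ^ (-θ₂)) * ((2 * Real.pi / b) ^ (e₁ L) * 𝔐₁ L) ∧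
      R ≤ (K₃ * (L : ℝ) ^ q₃ * b ^ (-θ₃)) * ((2 * Real.pi / b) ^ (e₁ L) * 𝔐₁ L)) :
    Summit.QuantumFields.YangMills.Theses.SwapVirialDeficit.SwapGluedStiffness := by
  -- the two sector integrals as total functions of `L` (value `0` at the excluded `L = 0`)
  let I₀ : ℕ → ℝ → ℝ := fun L b =>
    if h : L = 0 then 0 else ∫ P, Real.exp (-(b * @swapRingDeficit L ⟨h⟩ (fun _ => false) P)) ∂(@ringMeasure L ⟨h⟩)
  let I₁ : ℕ → ℝ → ℝ := fun L b =>
    if h : L = 0 then 0 else ∫ P, Real.exp (-(b * @swapRingDeficit L ⟨h⟩ (fun k => decide (k = 2)) P)) ∂(@ringMeasure L ⟨h⟩)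
  have hI₀ : ∀ (L : ℕ) [NeZero L] (b : ℝ), I₀ L b = ∫ P, Real.exp (-(b * swapRingDeficit L (fun _ => false) P)) ∂(ringMeasure L) :=
    fun L _ b => by simp only [I₀, dif_neg (NeZero.ne L)]
  have hI₁ : ∀ (L : ℕ) [NeZero L] (b : ℝ), I₁ L b = ∫ P, Real.exp (-(b * swapRingDeficit L (fun k => decide (k = 2)) P)) ∂(ringMeasure L) :=
    fun L _ b => by simp only [I₁, dif_neg (NeZero.ne L)]
  -- the per-(L,b) data in terms of `I₀`, `I₁`
  have h₀' : ∀ L : ℕ, L₀ ≤ L → ∀ b : ℝ, K₁ * (L : ℝ) ^ q₁ ≤ b → ∃ Ib R : ℝ, Ib ≤ I₀ L b ∧ I₀ L b ≤ Ib + R ∧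
      |Ib - (2 * Real.pi / b) ^ (e₀ L) * 𝔐₀ L| ≤ (K₂ * (L : ℝ) ^ q₂ * b ^ (-θ₂)) * ((2 * Real.pi / b) ^ (e₀ L) * 𝔐₀ L) ∧
      R ≤ (K₃ * (L : ℝ) ^ q₃ * b ^ (-θ₃)) * ((2 * Real.pi / b) ^ (e₀ L) * 𝔐₀ L) := by
    intro L hL b hb
    haveI : NeZero L := ⟨by omega⟩
    rw [hI₀ L b]
    exact h₀ L hL b hb
  have h₁' : ∀ L : ℕ, L₀ ≤ L → ∀ b : ℝ, K₁ * (L : ℝ) ^ q₁ ≤ b → ∃ Ib R : ℝ, Ib ≤ I₁ L b ∧ I₁ L b ≤ Ib + R ∧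
      |Ib - (2 * Real.pi / b) ^ (e₁ L) * 𝔐₁ L| ≤ (K₂ * (L : ℝ) ^ q₂ * b ^ (-θ₂)) * ((2 * Real.pi / b) ^ (e₁ L) * 𝔐₁ L) ∧
      R ≤ (K₃ * (L : ℝ) ^ q₃ * b ^ (-θ₃)) * ((2 * Real.pi / b) ^ (e₁ L) * 𝔐₁ L) := by
    intro L hL b hb
    haveI : NeZero L := ⟨by omega⟩
    rw [hI₁ L b]
    exact h₁ L hL b hb
  -- the two window laws
  obtain ⟨a₀, ha₀, A₀, hA₀, p₀, t₀, ht₀, ht₀1, β₀, hS₀⟩ := sharpLaw_on_window_of_bulk_rest_rate (I := I₀) hK₁ hK₂ hK₃ hθ₂ hθ₂1 hθ₃ hq₁ hL₀ h𝔐₀ h₀'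
  obtain ⟨a₁, ha₁, A₁, hA₁, p₁, t₁, ht₁, ht₁1, β₁, hS₁⟩ := sharpLaw_on_window_of_bulk_rest_rate (I := I₁) hK₁ hK₂ hK₃ hθ₂ hθ₂1 hθ₃ hq₁ hL₀ h𝔐₁ h₁'
  -- common window ∕ constants
  set a : ℝ := min a₀ a₁ with hadef
  set A : ℝ := A₀ + A₁ with hAdef
  set p : ℕ := max p₀ p₁ with hpdef
  set t : ℝ := min t₀ t₁ with htdef
  set β : ℝ := max (max β₀ β₁) 1 with hβdef
  refine swapGluedStiffness_of_sharpSectorLaplace ⟨a, lt_min ha₀ ha₁, A, by positivity, (p : ℝ), Nat.cast_nonneg _, t, lt_min ht₀ ht₁,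
    (min_le_left _ _).trans ht₀1, e₀, e₁, fun L => Real.log (𝔐₀ L) + e₀ L * Real.log (2 * Real.pi), fun L => Real.log (𝔐₁ L) + e₁ L * Real.log (2 * Real.pi),
    β, L₀, hexp, fun b hb L _ hL hLb => ?_⟩
  have hb1 : (1 : ℝ) ≤ b := (le_max_right _ _).trans hb
  have hbβ₀ : β₀ ≤ b := ((le_max_left _ _).trans (le_max_left _ _)).trans hb
  have hbβ₁ : β₁ ≤ b := ((le_max_right _ _).trans (le_max_left _ _)).trans hb
  have hL1 : (1 : ℝ) ≤ L := by exact_mod_cast hL₀.trans hL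
  have hLa₀ : (L : ℝ) ≤ b ^ a₀ := hLb.trans (Real.rpow_le_rpow_of_exponent_le hb1 (min_le_left _ _))
  have hLa₁ : (L : ℝ) ≤ b ^ a₁ := hLb.trans (Real.rpow_le_rpow_of_exponent_le hb1 (min_le_right _ _))
  obtain ⟨-, hlaw₀⟩ := hS₀ b hbβ₀ L hL hLa₀
  obtain ⟨-, hlaw₁⟩ := hS₁ b hbβ₁ L hL hLa₁
  rw [hI₀ L b] at hlaw₀
  rw [hI₁ L b] at hlaw₁
  -- enlarge both bounds to `A · L^p · b^{−t}`
  have hmono : 0 ≤ (L : ℝ) ^ p * b ^ (-t) := by positivity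
  have hbig₀ : A₀ * (L : ℝ) ^ p₀ * b ^ (-t₀) ≤ A * (L : ℝ) ^ (p : ℝ) * b ^ (-t) := by
    have h1 := monomial_le_of_window hA₀.le hL1 hb1 (le_max_left p₀ p₁) (min_le_left t₀ t₁)
    rw [Real.rpow_natCast]
    refine h1.trans ?_
    have : A₀ * (L : ℝ) ^ p * b ^ (-t) ≤ A * (L : ℝ) ^ p * b ^ (-t) := by
      rw [mul_assoc, mul_assoc]; exact mul_le_mul_of_nonneg_right (by rw [hAdef]; linarith) hmono
    exact this
  have hbig₁ : A₁ * (L : ℝ) ^ p₁ * b ^ (-t₁) ≤ A * (L : ℝ) ^ (p : ℝ) * b ^ (-t) := by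
    have h1 := monomial_le_of_window hA₁.le hL1 hb1 (le_max_right p₀ p₁) (min_le_right t₀ t₁)
    rw [Real.rpow_natCast]
    refine h1.trans ?_
    have : A₁ * (L : ℝ) ^ p * b ^ (-t) ≤ A * (L : ℝ) ^ p * b ^ (-t) := by
      rw [mul_assoc, mul_assoc]; exact mul_le_mul_of_nonneg_right (by rw [hAdef]; linarith) hmono
    exact this
  exact ⟨hlaw₀.trans hbig₀, hlaw₁.trans hbig₁⟩

/-- ★★★ **⟨24194⟩ `SwapMeanActionGap` FROM PER-SECTOR, PER-`(L,b)` POLYNOMIAL BULK∕REST DATA AT A GENERAL BULK RATE `θ₂`** (LEAD g97's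
✓`swapMeanActionGap_of_bulk_rest` verbatim with `b^{−1∕2}` ↦ `b^{−θ₂}`, `0 < θ₂ ≤ 1`; SAME hypotheses and binder names as `swapGluedStiffness_of_bulk_rest_rate`,
so ONE set of Morse–Bott data closes ⟨24197⟩ and ⟨24194⟩). [cite: tHooft1979] [cite: Luscher1983, §2] [folklore] -/
theorem swapMeanActionGap_of_bulk_rest_rate {e₀ e₁ 𝔐₀ 𝔐₁ : ℕ → ℝ} {K₁ K₂ K₃ θ₂ θ₃ : ℝ} {q₁ q₂ q₃ L₀ : ℕ}
    (hK₁ : 0 < K₁) (hK₂ : 0 ≤ K₂) (hK₃ : 0 ≤ K₃) (hθ₂ : 0 < θ₂) (hθ₂1 : θ₂ ≤ 1) (hθ₃ : 0 < θ₃) (hq₁ : 1 ≤ q₁) (hL₀ : 1 ≤ L₀)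
    (hexp : ∀ L : ℕ, L₀ ≤ L → 9 * (L : ℝ) ^ 4 - 1 ≤ e₀ L ∧ e₀ L ≤ 9 * (L : ℝ) ^ 4 ∧ 9 * (L : ℝ) ^ 4 - 1 ≤ e₁ L ∧ e₁ L ≤ 9 * (L : ℝ) ^ 4)
    (h𝔐₀ : ∀ L : ℕ, L₀ ≤ L → 0 < 𝔐₀ L) (h𝔐₁ : ∀ L : ℕ, L₀ ≤ L → 0 < 𝔐₁ L)
    (h₀ : ∀ (L : ℕ) [NeZero L], L₀ ≤ L → ∀ b : ℝ, K₁ * (L : ℝ) ^ q₁ ≤ b → ∃ Ib R : ℝ,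
      Ib ≤ ∫ P, Real.exp (-(b * swapRingDeficit L (fun _ => false) P)) ∂(ringMeasure L) ∧
      (∫ P, Real.exp (-(b * swapRingDeficit L (fun _ => false) P)) ∂(ringMeasure L)) ≤ Ib + R ∧
      |Ib - (2 * Real.pi / b) ^ (e₀ L) * 𝔐₀ L| ≤ (K₂ * (L : ℝ) ^ q₂ * b ^ (-θ₂)) * ((2 * Real.pi / b) ^ (e₀ L) * 𝔐₀ L) ∧
      R ≤ (K₃ * (L : ℝ) ^ q₃ * b ^ (-θ₃)) * ((2 * Real.pi / b) ^ (e₀ L) * 𝔐₀ L))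
    (h₁ : ∀ (L : ℕ) [NeZero L], L₀ ≤ L → ∀ b : ℝ, K₁ * (L : ℝ) ^ q₁ ≤ b → ∃ Ib R : ℝ,
      Ib ≤ ∫ P, Real.exp (-(b * swapRingDeficit L (fun k => decide (k = 2)) P)) ∂(ringMeasure L) ∧
      (∫ P, Real.exp (-(b * swapRingDeficit L (fun k => decide (k = 2)) P)) ∂(ringMeasure L)) ≤ Ib + R ∧
      |Ib - (2 * Real.pi / b) ^ (e₁ L) * 𝔐₁ L| ≤ (K₂ * (L : ℝ) ^ q₂ * b ^ (-θ₂)) * ((2 * Real.pi / b) ^ (e₁ L) * 𝔐₁ L) ∧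
      R ≤ (K₃ * (L : ℝ) ^ q₃ * b ^ (-θ₃)) * ((2 * Real.pi / b) ^ (e₁ L) * 𝔐₁ L)) :
    Summit.QuantumFields.YangMills.Theses.SwapVirialDeficit.SwapMeanActionGap := by
  -- the two sector integrals as total functions of `L` (value `0` at the excluded `L = 0`)
  let I₀ : ℕ → ℝ → ℝ := fun L b =>
    if h : L = 0 then 0 else ∫ P, Real.exp (-(b * @swapRingDeficit L ⟨h⟩ (fun _ => false) P)) ∂(@ringMeasure L ⟨h⟩)
  let I₁ : ℕ → ℝ → ℝ := fun L b =>
    if h : L = 0 then 0 else ∫ P, Real.exp (-(b * @swapRingDeficit L ⟨h⟩ (fun k => decide (k = 2)) P)) ∂(@ringMeasure L ⟨h⟩)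
  have hI₀ : ∀ (L : ℕ) [NeZero L] (b : ℝ), I₀ L b = ∫ P, Real.exp (-(b * swapRingDeficit L (fun _ => false) P)) ∂(ringMeasure L) :=
    fun L _ b => by simp only [I₀, dif_neg (NeZero.ne L)]
  have hI₁ : ∀ (L : ℕ) [NeZero L] (b : ℝ), I₁ L b = ∫ P, Real.exp (-(b * swapRingDeficit L (fun k => decide (k = 2)) P)) ∂(ringMeasure L) :=
    fun L _ b => by simp only [I₁, dif_neg (NeZero.ne L)]
  -- the per-(L,b) data in terms of `I₀`, `I₁`
  have h₀' : ∀ L : ℕ, L₀ ≤ L → ∀ b : ℝ, K₁ * (L : ℝ) ^ q₁ ≤ b → ∃ Ib R : ℝ, Ib ≤ I₀ L b ∧ I₀ L b ≤ Ib + R ∧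
      |Ib - (2 * Real.pi / b) ^ (e₀ L) * 𝔐₀ L| ≤ (K₂ * (L : ℝ) ^ q₂ * b ^ (-θ₂)) * ((2 * Real.pi / b) ^ (e₀ L) * 𝔐₀ L) ∧
      R ≤ (K₃ * (L : ℝ) ^ q₃ * b ^ (-θ₃)) * ((2 * Real.pi / b) ^ (e₀ L) * 𝔐₀ L) := by
    intro L hL b hb
    haveI : NeZero L := ⟨by omega⟩
    rw [hI₀ L b]
    exact h₀ L hL b hb
  have h₁' : ∀ L : ℕ, L₀ ≤ L → ∀ b : ℝ, K₁ * (L : ℝ) ^ q₁ ≤ b → ∃ Ib R : ℝ, Ib ≤ I₁ L b ∧ I₁ L b ≤ Ib + R ∧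
      |Ib - (2 * Real.pi / b) ^ (e₁ L) * 𝔐₁ L| ≤ (K₂ * (L : ℝ) ^ q₂ * b ^ (-θ₂)) * ((2 * Real.pi / b) ^ (e₁ L) * 𝔐₁ L) ∧
      R ≤ (K₃ * (L : ℝ) ^ q₃ * b ^ (-θ₃)) * ((2 * Real.pi / b) ^ (e₁ L) * 𝔐₁ L) := by
    intro L hL b hb
    haveI : NeZero L := ⟨by omega⟩
    rw [hI₁ L b]
    exact h₁ L hL b hb
  -- the two window laws
  obtain ⟨a₀, ha₀, A₀, hA₀, p₀, t₀, ht₀, ht₀1, β₀, hS₀⟩ := sharpLaw_on_window_of_bulk_rest_rate (I := I₀) hK₁ hK₂ hK₃ hθ₂ hθ₂1 hθ₃ hq₁ hL₀ h𝔐₀ h₀'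
  obtain ⟨a₁, ha₁, A₁, hA₁, p₁, t₁, ht₁, ht₁1, β₁, hS₁⟩ := sharpLaw_on_window_of_bulk_rest_rate (I := I₁) hK₁ hK₂ hK₃ hθ₂ hθ₂1 hθ₃ hq₁ hL₀ h𝔐₁ h₁'
  -- common window ∕ constants
  set a : ℝ := min a₀ a₁ with hadef
  set A : ℝ := A₀ + A₁ with hAdef
  set p : ℕ := max p₀ p₁ with hpdef
  set t : ℝ := min t₀ t₁ with htdef
  set β : ℝ := max (max β₀ β₁) 1 with hβdef
  refine Summit.QuantumFields.YangMills.Theorems.VirialFluxGap.FrameHessian.swapMeanActionGap_of_sharpSectorLaplace ⟨a, lt_min ha₀ ha₁, A, by positivity, (p : ℝ), Nat.cast_nonneg _, t, lt_min ht₀ ht₁,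
    (min_le_left _ _).trans ht₀1, e₀, e₁, fun L => Real.log (𝔐₀ L) + e₀ L * Real.log (2 * Real.pi), fun L => Real.log (𝔐₁ L) + e₁ L * Real.log (2 * Real.pi),
    β, L₀, hexp, fun b hb L _ hL hLb => ?_⟩
  have hb1 : (1 : ℝ) ≤ b := (le_max_right _ _).trans hb
  have hbβ₀ : β₀ ≤ b := ((le_max_left _ _).trans (le_max_left _ _)).trans hb
  have hbβ₁ : β₁ ≤ b := ((le_max_right _ _).trans (le_max_left _ _)).trans hb
  have hL1 : (1 : ℝ) ≤ L := by exact_mod_cast hL₀.trans hL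
  have hLa₀ : (L : ℝ) ≤ b ^ a₀ := hLb.trans (Real.rpow_le_rpow_of_exponent_le hb1 (min_le_left _ _))
  have hLa₁ : (L : ℝ) ≤ b ^ a₁ := hLb.trans (Real.rpow_le_rpow_of_exponent_le hb1 (min_le_right _ _))
  obtain ⟨-, hlaw₀⟩ := hS₀ b hbβ₀ L hL hLa₀
  obtain ⟨-, hlaw₁⟩ := hS₁ b hbβ₁ L hL hLa₁
  rw [hI₀ L b] at hlaw₀
  rw [hI₁ L b] at hlaw₁
  -- enlarge both bounds to `A · L^p · b^{−t}`
  have hmono : 0 ≤ (L : ℝ) ^ p * b ^ (-t) := by positivity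
  have hbig₀ : A₀ * (L : ℝ) ^ p₀ * b ^ (-t₀) ≤ A * (L : ℝ) ^ (p : ℝ) * b ^ (-t) := by
    have h1 := monomial_le_of_window hA₀.le hL1 hb1 (le_max_left p₀ p₁) (min_le_left t₀ t₁)
    rw [Real.rpow_natCast]
    refine h1.trans ?_
    have : A₀ * (L : ℝ) ^ p * b ^ (-t) ≤ A * (L : ℝ) ^ p * b ^ (-t) := by
      rw [mul_assoc, mul_assoc]; exact mul_le_mul_of_nonneg_right (by rw [hAdef]; linarith) hmono
    exact this
  have hbig₁ : A₁ * (L : ℝ) ^ p₁ * b ^ (-t₁) ≤ A * (L : ℝ) ^ (p : ℝ) * b ^ (-t) := by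
    have h1 := monomial_le_of_window hA₁.le hL1 hb1 (le_max_right p₀ p₁) (min_le_right t₀ t₁)
    rw [Real.rpow_natCast]
    refine h1.trans ?_
    have : A₁ * (L : ℝ) ^ p * b ^ (-t) ≤ A * (L : ℝ) ^ p * b ^ (-t) := by
      rw [mul_assoc, mul_assoc]; exact mul_le_mul_of_nonneg_right (by rw [hAdef]; linarith) hmono
    exact this
  exact ⟨hlaw₀.trans hbig₀, hlaw₁.trans hbig₁⟩

end Summit.QuantumFields.YangMills.Theorems.SwapVirialDeficit.SwapRing

end
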